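import Mathlib
import Summits.ValiantsHypothesis.ValiantsHypothesis.Theorems.FifoMatchingNNLinearDegreeCofactorHardInflateWordRanks
import Summits.ValiantsHypothesis.ValiantsHypothesis.Theorems.FifoMatchingNNMonotoneHardPadBoundaries
import HarnessLib

/-!
# Crux `NNLinearDegreeCofactorHard` (stmt-ValiantsHypothesis-23918) / rung S11 (stmt-ValiantsHypothesis-24468), line
# `internal_cofactor`: the CANONICAL FORBIDDEN CODE SETS of the inflated word (test bookkeeping for (D‴)/(F‴))

For a colouring `σ` of the carved window (the adversary's split) and the inflated word `inflateWord R L m y`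
(`…InflateWordDefs.lean`), pair `j` occupies the non-defect positions of V-ranks `2j, 2j+1`; its SEGMENT is
`[vpos 2j, vpos (2j+2))` (the pair's two letters and the defect pops before the next pair).  A pop at position `t` VIOLATES
`σ` if the queue is nonempty at `t` and the front opener (the opener of rank `#closers<t`) has the other colour.  The canonical
forbidden set `forbidden R L m σ j y` is the set of codes `c` of pair `j` for which the word with `y`'s other bits and code `c` at
pair `j` has a violating pop inside segment `j`.  Then:

* `not_segViolates_of_resp`, `code_not_mem_forbidden` — if the FIFO pairing of the word respects `σ` (every arc
  monochromatic) then no segment violates, so the word's own code avoids every forbidden set (a tautology: this is what makes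
  `AdaptiveBlockTests.card_adaptiveAvoid_le` / `CondProb.sum_prod_condWeight_le_one` applicable with `Φ := forbidden`);
* `forbidden_eq_of_agree` — PAST-MEASURABILITY: for a middle pair (`2j+2 ≤ 2·jE`) the forbidden set depends on `y` only
  through the bits below `2j` (positions before `vpos (2j+2)` are defects or have V-rank `< 2j+2`; letters, ranks and the front
  opener below such a position are read off the agreeing prefix — `inflateWord_eq_of_agree`, `orderEmbOfFin_eq_of_filter`).

`tests R L m σ f y := #{j : f ≤ #forbidden}` is then the number of tests of strength `f` the word meets, in the sense of the
adaptive test lemma.  Definitions: `setPair`, `frontPos`, `popViolates`, `segViolates`, `forbidden`, `tests` (route-local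
bookkeeping, S8/D3plan §2).  Nothing here proves S11, S2b, the crux or VP ≠ VNP.
-/

noncomputable section

-- Sub = Summit single-conjunct layout: the duplicated namespace component is mandated by the tree.
set_option linter.dupNamespace false

namespace Summit.ValiantsHypothesis.ValiantsHypothesis.Theorems.FifoMatching.NNLinearDegreeCofactorHard.InflateWord

open Finset Literature.Computability.AlgebraicComplexity
open Summit.ValiantsHypothesis.ValiantsHypothesis.Theorems.FifoMatching.NNMonotoneHard

variable {N : ℕ} (R : Finset (Fin N)) (L m : ℕ)

/-- Set pair `j` of a bit string to the code `c`. [folklore] -/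
def setPair (j : ℕ) (c : Bool × Bool) (y : Fin (2 * (Rᶜ.card / 2)) → Bool) : Fin (2 * (Rᶜ.card / 2)) → Bool :=
  fun k => if k.val = 2 * j then c.1 else if k.val = 2 * j + 1 then c.2 else y k

/-- The code (two bits) of pair `j`. [folklore] -/
def code (j : ℕ) (y : Fin (2 * (Rᶜ.card / 2)) → Bool) : Bool × Bool :=
  ((if h : 2 * j < 2 * (Rᶜ.card / 2) then y ⟨2 * j, h⟩ else false),
    (if h : 2 * j + 1 < 2 * (Rᶜ.card / 2) then y ⟨2 * j + 1, h⟩ else false))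

/-- The position of the FRONT opener of a word at time `t` (the opener of rank `#closers<t`), `N` if the queue is empty.
[folklore] -/
def frontPos (W : Fin N → Bool) (t : ℕ) : ℕ :=
  if h : ((closerSet W).filter fun i => i.val < t).card < ((openerSet W).filter fun i => i.val < t).card then
    ((openerSet W).orderEmbOfFin rfl
      ⟨((closerSet W).filter fun i => i.val < t).card, lt_of_lt_of_le h (card_filter_le _ _)⟩).val
  else N

/-- A pop at position `t` VIOLATES the colouring `σ` (Boolean test): `t` is a closer, the queue is nonempty at `t`, and the
front opener has the other colour. [folklore] -/
def popViolates (σ : Fin N → Bool) (W : Fin N → Bool) (t : Fin N) : Bool :=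
  (W t == false) && decide (((closerSet W).filter fun i => i.val < t.val).card
      < ((openerSet W).filter fun i => i.val < t.val).card) &&
    ((if h : frontPos W t.val < N then σ ⟨frontPos W t.val, h⟩ else false) != σ t)

/-- Segment `j` of the inflated word (positions `[vpos 2j, vpos (2j+2))`) contains a violating pop (Boolean test).
[folklore] -/
def segViolates (σ : Fin N → Bool) (j : ℕ) (y : Fin (2 * (Rᶜ.card / 2)) → Bool) : Bool :=
  decide (∃ t : Fin N, vpos R (2 * j) ≤ t.val ∧ t.val < vpos R (2 * j + 2) ∧ popViolates σ (inflateWord R L m y) t = true)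

/-- **The canonical forbidden code set of pair `j`**: the codes that, with `y`'s other bits, produce a violating pop in
segment `j`. [folklore] -/
def forbidden (σ : Fin N → Bool) (j : ℕ) (y : Fin (2 * (Rᶜ.card / 2)) → Bool) : Finset (Bool × Bool) :=
  univ.filter fun c => segViolates R L m σ j (setPair R j c y) = true

/-- The number of tests of strength `f` met by the word: pairs whose forbidden set has at least `f` codes. [folklore] -/
def tests (σ : Fin N → Bool) (f : ℕ) (y : Fin (2 * (Rᶜ.card / 2)) → Bool) : ℕ :=
  ((range (Rᶜ.card / 2)).filter fun j => f ≤ (forbidden R L m σ j y).card).card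

variable (σ : Fin N → Bool) (y : Fin (2 * (Rᶜ.card / 2)) → Bool)

/-- Setting pair `j` to its own code changes nothing. [folklore] -/
theorem setPair_code (j : ℕ) : setPair R j (code R j y) y = y := by
  funext k
  unfold setPair code
  by_cases h0 : k.val = 2 * j
  · rw [if_pos h0]
    have hlt : 2 * j < 2 * (Rᶜ.card / 2) := by omega
    simp only [dif_pos hlt]
    exact congrArg y (Fin.ext h0.symm)
  · rw [if_neg h0]
    by_cases h1 : k.val = 2 * j + 1
    · rw [if_pos h1]
      have hlt : 2 * j + 1 < 2 * (Rᶜ.card / 2) := by omega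
      simp only [dif_pos hlt]
      exact congrArg y (Fin.ext h1.symm)
    · rw [if_neg h1]

/-! ### Respect ⇒ no violation ⇒ the word's code avoids every forbidden set -/

/-- **A word whose FIFO pairing respects `σ` has no violating pop.** [folklore] -/
theorem not_popViolates_of_resp {W : Fin N → Bool} (hbal : (closerSet W).card = (openerSet W).card)
    (hresp : ∀ k : Fin (openerSet W).card,
      σ ((openerSet W).orderEmbOfFin rfl k) = σ ((closerSet W).orderEmbOfFin hbal k))
    (t : Fin N) : popViolates σ W t = false := by
  rw [Bool.eq_false_iff]
  intro hv
  unfold popViolates at hv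
  simp only [Bool.and_eq_true, beq_iff_eq, decide_eq_true_eq, bne_iff_ne, ne_eq] at hv
  obtain ⟨⟨hWt, hq⟩, hcol⟩ := hv
  set q := ((closerSet W).filter fun i => i.val < t.val).card with hqdef
  have hqlt : q < (openerSet W).card := lt_of_lt_of_le hq (card_filter_le _ _)
  have hfront : frontPos W t.val = ((openerSet W).orderEmbOfFin rfl ⟨q, hqlt⟩).val := by
    unfold frontPos; rw [dif_pos hq]
  have hc : (closerSet W).orderEmbOfFin hbal ⟨q, hqlt⟩ = t := by
    refine closer_eq_orderEmbOfFin hWt ⟨q, hqlt⟩ ?_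
    rw [filter_lt_fin_eq]
  have h := hresp ⟨q, hqlt⟩
  rw [hc] at h
  apply hcol
  rw [hfront, dif_pos (Fin.isLt _)]
  simpa using h

/-- Hence no segment violates. [folklore] -/
theorem not_segViolates_of_resp (hbal : (closerSet (inflateWord R L m y)).card = (openerSet (inflateWord R L m y)).card)
    (hresp : ∀ k : Fin (openerSet (inflateWord R L m y)).card,
      σ ((openerSet (inflateWord R L m y)).orderEmbOfFin rfl k)
        = σ ((closerSet (inflateWord R L m y)).orderEmbOfFin hbal k))
    (j : ℕ) : segViolates R L m σ j y = false := by
  rw [Bool.eq_false_iff]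
  intro hv
  unfold segViolates at hv
  rw [decide_eq_true_eq] at hv
  obtain ⟨t, -, -, ht⟩ := hv
  rw [not_popViolates_of_resp σ hbal hresp t] at ht
  exact Bool.false_ne_true ht

/-- **A respecting word's own code avoids every canonical forbidden set.** [folklore] -/
theorem code_not_mem_forbidden (hbal : (closerSet (inflateWord R L m y)).card = (openerSet (inflateWord R L m y)).card)
    (hresp : ∀ k : Fin (openerSet (inflateWord R L m y)).card,
      σ ((openerSet (inflateWord R L m y)).orderEmbOfFin rfl k)
        = σ ((closerSet (inflateWord R L m y)).orderEmbOfFin hbal k))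
    (j : ℕ) : code R j y ∉ forbidden R L m σ j y := by
  unfold forbidden
  rw [mem_filter, setPair_code, not_segViolates_of_resp R L m σ y hbal hresp j]
  simp

/-! ### Past-measurability of the forbidden sets -/

/-- Two words agreeing below position `u` have the same opener and closer counts below every `t ≤ u`. [folklore] -/
theorem filter_lt_eq_of_agree' {W W' : Fin N → Bool} {u : ℕ} (h : ∀ s : Fin N, s.val < u → W s = W' s)
    (t : ℕ) (ht : t ≤ u) :
    ((openerSet W).filter fun i => i.val < t) = ((openerSet W').filter fun i => i.val < t) ∧
      ((closerSet W).filter fun i => i.val < t) = ((closerSet W').filter fun i => i.val < t) := by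
  constructor <;>
  · ext i
    simp only [mem_filter, mem_openerSet, mem_closerSet]
    constructor <;> rintro ⟨h1, h2⟩ <;> refine ⟨?_, h2⟩
    · rwa [← h i (by omega)]
    · rwa [h i (by omega)]

/-- The `q`-th elements of two equal finsets agree. [folklore] -/
theorem orderEmbOfFin_congr_set {s₁ s₂ : Finset (Fin N)} (e : s₁ = s₂) (q : ℕ) (h₁ : q < s₁.card) (h₂ : q < s₂.card) :
    s₁.orderEmbOfFin rfl ⟨q, h₁⟩ = s₂.orderEmbOfFin rfl ⟨q, h₂⟩ := by
  subst e; rfl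

/-- … and the same front opener at every `t ≤ u`. [folklore] -/
theorem frontPos_eq_of_agree {W W' : Fin N → Bool} {u : ℕ} (h : ∀ s : Fin N, s.val < u → W s = W' s)
    (t : ℕ) (ht : t ≤ u) (htN : t ≤ N) : frontPos W t = frontPos W' t := by
  obtain ⟨ho, hc⟩ := filter_lt_eq_of_agree' h t ht
  rcases htN.eq_or_lt with rfl | htN'
  · -- `t = N`: the words agree everywhere
    have hall : W = W' := funext fun s => h s (by omega)
    subst hall; rfl
  unfold frontPos
  by_cases hq : ((closerSet W).filter fun i => i.val < t).card < ((openerSet W).filter fun i => i.val < t).card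
  · have hq' : ((closerSet W').filter fun i => i.val < t).card < ((openerSet W').filter fun i => i.val < t).card := by
      rwa [← ho, ← hc]
    rw [dif_pos hq, dif_pos hq']
    have e1 := orderEmbOfFin_eq_of_filter (openerSet W) rfl ⟨t, htN'⟩
      ⟨_, lt_of_lt_of_le hq (card_filter_le _ _)⟩ (by rw [filter_lt_fin_eq]; exact hq)
    have e2 := orderEmbOfFin_eq_of_filter (openerSet W') rfl ⟨t, htN'⟩
      ⟨_, lt_of_lt_of_le hq' (card_filter_le _ _)⟩ (by rw [filter_lt_fin_eq]; exact hq')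
    rw [e1, e2]
    have hsets : ((openerSet W).filter fun i => i < (⟨t, htN'⟩ : Fin N))
        = ((openerSet W').filter fun i => i < (⟨t, htN'⟩ : Fin N)) := by
      rw [filter_lt_fin_eq, filter_lt_fin_eq]; exact ho
    have := orderEmbOfFin_congr_set hsets ((closerSet W).filter fun i => i.val < t).card
      (by rw [filter_lt_fin_eq]; exact hq) (by rw [filter_lt_fin_eq, hc]; exact hq')
    rw [this]
    congr 2
    exact Fin.ext (by simp [hc])
  · have hq' : ¬ ((closerSet W').filter fun i => i.val < t).card < ((openerSet W').filter fun i => i.val < t).card := by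
      rwa [← ho, ← hc]
    rw [dif_neg hq, dif_neg hq']

/-- **Past-measurability of the canonical forbidden sets.**  If two bit strings agree on the bits below `2j` and pair `j` is
not the last before the tail (`2j + 2 ≤ 2·jE`), their forbidden sets at pair `j` coincide. [folklore] -/
theorem forbidden_eq_of_agree (j : ℕ) (hj : 2 * j + 2 ≤ 2 * tailPairs R L m)
    {y y' : Fin (2 * (Rᶜ.card / 2)) → Bool} (hyy' : ∀ b : Fin (2 * (Rᶜ.card / 2)), b.val < 2 * j → y b = y' b) :
    forbidden R L m σ j y = forbidden R L m σ j y' := by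
  unfold forbidden
  refine filter_congr fun c _ => ?_
  -- the two words with code `c` at pair `j` agree below `vpos (2j+2)`
  have hagree : ∀ s : Fin N, s.val < vpos R (2 * j + 2) →
      inflateWord R L m (setPair R j c y) s = inflateWord R L m (setPair R j c y') s := by
    intro s hs
    by_cases hsR : s ∈ R
    · rw [inflateWord_apply_of_mem R L m _ hsR, inflateWord_apply_of_mem R L m _ hsR]
    · have hvr : vrank R s < 2 * j + 2 := by
        have h1 := vrank_succ R s
        rw [if_neg hsR] at h1
        have h2 := vrank_mono R (Nat.succ_le_of_lt hs)
        rw [h1] at h2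
        rcases (le_trans hj (two_mul_tailPairs_le' R L m)).eq_or_lt with h3 | h3
        · rw [vpos_of_le R h3.ge, vrank_of_le R le_rfl] at h2; omega
        · rw [vrank_vpos R h3] at h2; omega
      refine inflateWord_eq_of_agree R L m (j := j + 1) (fun b hb => ?_) (by omega) (by omega)
      unfold setPair
      by_cases h0 : b.val = 2 * j
      · rw [if_pos h0, if_pos h0]
      · rw [if_neg h0, if_neg h0]
        by_cases h1 : b.val = 2 * j + 1
        · rw [if_pos h1, if_pos h1]
        · rw [if_neg h1, if_neg h1]; exact hyy' b (by omega)
  -- the violation tests agree pointwise below `vpos (2j+2)`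
  have hpt : ∀ t : Fin N, t.val < vpos R (2 * j + 2) →
      popViolates σ (inflateWord R L m (setPair R j c y)) t = popViolates σ (inflateWord R L m (setPair R j c y')) t := by
    intro t ht
    unfold popViolates
    obtain ⟨ho, hc⟩ := filter_lt_eq_of_agree' hagree t.val ht.le
    rw [hagree t ht, ho, hc, frontPos_eq_of_agree hagree t.val ht.le t.isLt.le]
  have key : (∃ t : Fin N, vpos R (2 * j) ≤ t.val ∧ t.val < vpos R (2 * j + 2) ∧
        popViolates σ (inflateWord R L m (setPair R j c y)) t = true)
      ↔ (∃ t : Fin N, vpos R (2 * j) ≤ t.val ∧ t.val < vpos R (2 * j + 2) ∧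
        popViolates σ (inflateWord R L m (setPair R j c y')) t = true) := by
    constructor <;> rintro ⟨t, h1, h2, h3⟩ <;> refine ⟨t, h1, h2, ?_⟩
    · rwa [← hpt t h2]
    · rwa [hpt t h2]
  unfold segViolates
  rw [decide_eq_true_iff, decide_eq_true_iff]
  exact key
where
  /-- `2·jE ≤ #Rᶜ` (local copy). -/
  two_mul_tailPairs_le' {N : ℕ} (R : Finset (Fin N)) (L m : ℕ) : 2 * tailPairs R L m ≤ Rᶜ.card := by
    unfold tailPairs; omega

end Summit.ValiantsHypothesis.ValiantsHypothesis.Theorems.FifoMatching.NNLinearDegreeCofactorHard.InflateWord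

end
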